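import Literature.Barriers.BirchSwinnertonDyer.PAdicFunctionalEquationParityProofs
import Literature.NumberTheory.EllipticCurves.Selmer

/-!
# BirchSwinnertonDyer / PAdicOrderV2 — crux `PAdicOrderPadicBSDrankR2` (stmt-0490), line `Sketch`,
# stub `stub_padicBSDrank_noExcessOne`: no excess zero at level one, odd `p`

Registered stub of the skeleton `Cruxes/PAdicOrderPadicBSDrankR2/Lines/Sketch.lean` (idea
`pconverse-corank-split`). For `E/ℚ` (globally minimal `W`), an odd good ordinary prime `p` and the
newform `f ∈ S₂(Γ₀(N))` of `E`, with `L_p(E,T) = padicLFunction f (unitRoot W p) ∈ ℚ_p⟦T⟧`: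
granting, at the point `(E,p,f)`,

* Kato's bound `corank_{ℤ_p} Sel_{p^∞}(E/ℚ) ≤ ord_{T=0} L_p(E,T)` (Kato 2004, Thm. 18.4),
* the `p`-parity theorem `corank_{ℤ_p} Sel_{p^∞}(E/ℚ) ≡ ord_{s=1} L(E,s) (mod 2)`
  (Dokchitser–Dokchitser 2010, Thm. 1.4),
* Carayol's `N = N_E` (the level of the newform is the conductor),

one has `ord_{T=0} L_p(E,T) = 1 ⇒ corank_{ℤ_p} Sel_{p^∞}(E/ℚ) = 1`.

Proof. Substitute `N = N_E`; at the conductor level the `p`-adic functional equation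
(Mazur–Tate–Teitelbaum 1986, §I.17) and complex parity are tree theorems, whence Greenberg's
"simple zero of `L_p` ⇒ odd order of `L(E,s)` at `s = 1`"
(`odd_analyticRank_of_order_padicLFunction_eq_one_conductorLevel`, Greenberg LNM 1716, §5, p. 181).
So `r_an` is odd, hence `corank` is odd by `p`-parity, and `corank ≤ 1` by Kato: `corank = 1`.
-/

-- D-0017: single-problem summit, so `Summit.BirchSwinnertonDyer.BirchSwinnertonDyer.…` repeats a
-- namespace BY DESIGN.
set_option linter.dupNamespace false

namespace Summit.BirchSwinnertonDyer.BirchSwinnertonDyer.Theorems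

open scoped MatrixGroups ModularForm
open CongruenceSubgroup Literature.NumberTheory.EllipticCurves
  Literature.NumberTheory.EllipticCurves.ModularForms

/-- **No excess zero at level one, odd `p`.** Granting, at the point `(E,p,f)`, Kato's
bound `corank Sel_{p^∞} ≤ ord_T L_p` (Kato 2004 Thm 18.4), the `p`-parity theorem
`corank ≡ r_an (mod 2)` (Dokchitser–Dokchitser 2010 Thm 1.4) and Carayol's `N = N_E` (whence the
`p`-adic functional equation MTT §I.17 and complex parity are tree theorems:
`odd_analyticRank_of_order_padicLFunction_eq_one_conductorLevel`):
`ord_{T=0} L_p(E,T) = 1 ⇒ corank_{ℤ_p} Sel_{p^∞}(E/ℚ) = 1`.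
[cite: GreenbergLNM1716, §1 Thm 1.5 and §5 (p. 181)] -/
theorem stub_padicBSDrank_noExcessOne :
    ∀ (W : WeierstrassCurve ℚ) [W.IsElliptic] [W.IsGloballyMinimal] (p : ℕ) [Fact p.Prime],
      p ≠ 2 → IsOrdinaryAt W p → ∀ {N : ℕ} [NeZero N] (f : CuspForm (Gamma0 N) 2), IsNewformOf W f →
      (W.selmerCorank p : ℕ∞) ≤ (padicLFunction f (unitRoot W p : ℚ_[p])).order →
      W.selmerCorank p % 2 = W.analyticRank % 2 →
      N = W.conductorNorm ℤ →
      (padicLFunction f (unitRoot W p : ℚ_[p])).order = 1 → W.selmerCorank p = 1 := by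
  intro W _ _ p _ hp hord N _ f hf hkato hpar hN h1
  subst hN
  have hodd : Odd W.analyticRank :=
    Literature.Barriers.BirchSwinnertonDyer.odd_analyticRank_of_order_padicLFunction_eq_one_conductorLevel
      hp hord hf h1
  have hle : W.selmerCorank p ≤ 1 := by
    rw [h1] at hkato
    exact_mod_cast hkato
  have h2 : W.analyticRank % 2 = 1 := Nat.odd_iff.mp hodd
  omega

end Summit.BirchSwinnertonDyer.BirchSwinnertonDyer.Theorems
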